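import Mathlib.Data.Fin.VecNotation
import Literature.Computability.QuantumComplexity.ShallowCircuitsNecklace
import HarnessLib

/-!
# Rectangle necklaces in the grid

Trunk `CryptoQuantFine` / family `quantum-advantage`. The concrete even cycles used in the
classical lower bound of Bravyi–Gosset–König (*Quantum advantage with shallow circuits*,
Science 362 (2018), arXiv:1704.00690, §4.2): the boundary of an axis-parallel rectangle of the
`N × N` grid with even side lengths `2·hw`, `2·hh` and top-left corner `(r₁, c₁)`, traversed
clockwise from the corner, with the three hubs `u` (top side), `v` (right side), `w` (bottom
side) at even offsets. This replaces the boxes-and-disjoint-paths cycle of BGK Claims 6–7 by a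
rigid shape; the only property of the cycle used downstream is the partition of its positions
into the four sides (`RectData.zone`: top and left side → `u`, right side → `v`, bottom side →
`w`), recorded in `RectData.zone_spec`, together with the compatibility `zone_ne_arcOf` with the
triangle sides of `ShallowCircuitsNecklace`.

## References

* S. Bravyi, D. Gosset, R. König, *Quantum advantage with shallow circuits*, Science 362 (2018)
  308–311, arXiv:1704.00690, §4.1 (Fig. 2), §4.2 (Claims 6, 7 and Eq. (31)).
  Section, claim, figure and equation numbers are those of arXiv:1704.00690v1.
-/

namespace Literature.Computability.QuantumComplexity

open Finset SimpleGraph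

/-- The data of a rectangle necklace in the `N × N` grid: top-left corner `(r₁, c₁)`, half
side lengths `hw, hh ≥ 1` (the rectangle has corners `(r₁, c₁)` and `(r₁ + 2hh, c₁ + 2hw)`), and
the half offsets `a, b, c` of the hubs `u = (r₁, c₁ + 2a)` on the top side,
`v = (r₁ + 2b, c₁ + 2hw)` on the right side and `w = (r₁ + 2hh, c₁ + 2hw - 2c)` on the bottom
side, all in the interiors of their sides. (Bravyi–Gosset–König 2018, §4.2: the cycle `Γ`
through `u, v, w ∈ V_even`.) [cite: BravyiGossetKonigScience2018, §4.2 Claim 7] -/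
structure RectData (N : ℕ) where
  /-- Row of the top side. -/
  r₁ : ℕ
  /-- Column of the left side. -/
  c₁ : ℕ
  /-- Half the width. -/
  hw : ℕ
  /-- Half the height. -/
  hh : ℕ
  /-- Half the offset of `u` along the top side. -/
  a : ℕ
  /-- Half the offset of `v` down the right side. -/
  b : ℕ
  /-- Half the offset of `w` along the bottom side (from the right). -/
  c : ℕ
  a_pos : 0 < a
  a_lt : a < hw
  b_pos : 0 < b
  b_lt : b < hh
  c_pos : 0 < c
  c_lt : c < hw
  row_lt : r₁ + 2 * hh < N
  col_lt : c₁ + 2 * hw < N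

namespace RectData

variable {N : ℕ} (R : RectData N)

/-- Half the perimeter: the necklace has `2 m` positions. [folklore] -/
def m : ℕ := 2 * (R.hw + R.hh)

/-- The perimeter is positive. [folklore] -/
theorem m_pos : 0 < R.m := by
  have := R.a_lt; unfold m; omega

/-- The perimeter is nonzero (instance feeding `Necklace N R.m`). [folklore] -/
instance : NeZero R.m := ⟨R.m_pos.ne'⟩

/-- Row of the `k`-th boundary point (clockwise from the top-left corner). [folklore] -/
def posRow (k : ℕ) : ℕ :=
  if k ≤ 2 * R.hw then R.r₁
  else if k ≤ 2 * R.hw + 2 * R.hh then R.r₁ + (k - 2 * R.hw)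
  else if k ≤ 4 * R.hw + 2 * R.hh then R.r₁ + 2 * R.hh
  else R.r₁ + (4 * R.hw + 4 * R.hh - k)

/-- Column of the `k`-th boundary point (clockwise from the top-left corner). [folklore] -/
def posCol (k : ℕ) : ℕ :=
  if k ≤ 2 * R.hw then R.c₁ + k
  else if k ≤ 2 * R.hw + 2 * R.hh then R.c₁ + 2 * R.hw
  else if k ≤ 4 * R.hw + 2 * R.hh then R.c₁ + (4 * R.hw + 2 * R.hh - k)
  else R.c₁

/-- Boundary points lie in the grid (rows). [folklore] -/
theorem posRow_lt (k : ℕ) : R.posRow k < N := by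
  have := R.row_lt
  unfold posRow; split_ifs <;> omega

/-- Boundary points lie in the grid (columns). [folklore] -/
theorem posCol_lt (k : ℕ) : R.posCol k < N := by
  have := R.col_lt
  unfold posCol; split_ifs <;> omega

/-- The boundary index of a point of the rectangle boundary (a left inverse of
`(posRow, posCol)` on `[0, 2m)`). [folklore] -/
def inv (i j : ℕ) : ℕ :=
  if i = R.r₁ then j - R.c₁
  else if j = R.c₁ + 2 * R.hw then 2 * R.hw + (i - R.r₁)
  else if i = R.r₁ + 2 * R.hh then 4 * R.hw + 2 * R.hh - (j - R.c₁)
  else 4 * R.hw + 4 * R.hh - (i - R.r₁)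

/-- `inv` inverts the boundary parametrisation. [folklore] -/
theorem inv_pos {k : ℕ} (hk : k < 2 * R.m) : R.inv (R.posRow k) (R.posCol k) = k := by
  have h1 := R.a_lt; have h2 := R.b_lt
  unfold inv posRow posCol m at *
  split_ifs <;> omega

/-- The boundary index of a necklace position: `2t` for `(t, false)`, `2t + 1` for
`(t, true)`. [folklore] -/
def kOf (p : Fin R.m × Bool) : ℕ := 2 * p.1.val + p.2.toNat

/-- Boundary indices are `< 2m`. [folklore] -/
theorem kOf_lt (p : Fin R.m × Bool) : R.kOf p < 2 * R.m := by
  have := p.1.isLt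
  unfold kOf
  cases p.2 <;> simp; omega

/-- `kOf` is injective. [folklore] -/
theorem kOf_injective : Function.Injective R.kOf := by
  rintro ⟨t, b⟩ ⟨t', b'⟩ h
  unfold kOf at h
  cases b <;> cases b' <;> simp at h ⊢ <;> first | (exact Fin.ext (by omega)) | omega

/-- The embedding of the necklace positions into the grid. [folklore] -/
def toFun (p : Fin R.m × Bool) : Fin N × Fin N :=
  (⟨R.posRow (R.kOf p), R.posRow_lt _⟩, ⟨R.posCol (R.kOf p), R.posCol_lt _⟩)

/-- The embedding is injective. [folklore] -/
theorem toFun_injective : Function.Injective R.toFun := by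
  intro p q h
  apply R.kOf_injective
  have h1 : R.posRow (R.kOf p) = R.posRow (R.kOf q) := congrArg (fun x => x.1.val) h
  have h2 : R.posCol (R.kOf p) = R.posCol (R.kOf q) := congrArg (fun x => x.2.val) h
  rw [← R.inv_pos (R.kOf_lt p), ← R.inv_pos (R.kOf_lt q), h1, h2]

/-- Grid adjacency of two points given by natural coordinates. [folklore] -/
def NatAdj (i j i' j' : ℕ) : Prop := (i = i' ∧ (j + 1 = j' ∨ j' + 1 = j)) ∨ (j = j' ∧ (i + 1 = i' ∨ i' + 1 = i))

/-- Consecutive boundary points are grid neighbours. [folklore] -/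
theorem natAdj_succ {k : ℕ} (hk : k + 1 < 2 * R.m) :
    NatAdj (R.posRow k) (R.posCol k) (R.posRow (k + 1)) (R.posCol (k + 1)) := by
  have h1 := R.a_lt; have h2 := R.b_lt
  unfold NatAdj posRow posCol m at *
  split_ifs <;> omega

/-- The last boundary point is a grid neighbour of the first. [folklore] -/
theorem natAdj_last : NatAdj (R.posRow (2 * R.m - 1)) (R.posCol (2 * R.m - 1)) (R.posRow 0) (R.posCol 0) := by
  have h1 := R.a_lt; have h2 := R.b_lt
  unfold NatAdj posRow posCol m at *
  split_ifs <;> omega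

/-- `NatAdj` on coordinates is grid adjacency. [folklore] -/
theorem gridGraph_adj_of_natAdj {x y : Fin N × Fin N} (h : NatAdj x.1.val x.2.val y.1.val y.2.val) :
    (gridGraph N).Adj x y := by
  rw [boxProd_adj, pathGraph_adj, pathGraph_adj]
  unfold NatAdj at h
  rcases h with ⟨h1, h2⟩ | ⟨h1, h2⟩
  · right; exact ⟨h2, Fin.ext h1⟩
  · left; exact ⟨h2, Fin.ext h1⟩

/-- Grid adjacency is symmetric (coordinate form). [folklore] -/
theorem natAdj_symm {i j i' j' : ℕ} (h : NatAdj i j i' j') : NatAdj i' j' i j := by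
  unfold NatAdj at *; omega

/-- Consecutive necklace positions are embedded to grid neighbours. [folklore] -/
theorem toFun_adj (p q : Fin R.m × Bool) (h : NAdj p q) : (gridGraph N).Adj (R.toFun p) (R.toFun q) := by
  apply gridGraph_adj_of_natAdj
  simp only [toFun]
  have hm := R.m_pos
  -- reduce to the boundary indices
  have key : ∀ p q : Fin R.m × Bool, (R.kOf q = R.kOf p + 1 ∨ (R.kOf p = 2 * R.m - 1 ∧ R.kOf q = 0)) →
      NatAdj (R.posRow (R.kOf p)) (R.posCol (R.kOf p)) (R.posRow (R.kOf q)) (R.posCol (R.kOf q)) := by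
    intro p q hpq
    rcases hpq with h | ⟨h1, h2⟩
    · rw [h]; exact R.natAdj_succ (h ▸ R.kOf_lt q)
    · rw [h1, h2]; exact R.natAdj_last
  obtain ⟨t, b⟩ := p
  obtain ⟨t', b'⟩ := q
  unfold NAdj at h
  simp only at h
  rcases h with ⟨rfl, rfl, h | h⟩ | ⟨rfl, rfl, h | h⟩
  · -- (t,false) ~ (t,true)
    subst h
    apply key; left; simp [kOf]
  · -- (t,false) ~ (t'‚true) with t' + 1 = t
    subst h
    apply natAdj_symm
    apply key
    simp only [kOf, Bool.toNat_true, Bool.toNat_false, add_zero, Fin.val_add]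
    have ht := t'.isLt
    rw [Fin.val_one', Nat.mod_eq_of_lt (show 1 < R.m by have := R.a_lt; unfold m; omega)]
    by_cases hc : t'.val + 1 < R.m
    · left; rw [Nat.mod_eq_of_lt hc]; ring
    · right
      have he : t'.val + 1 = R.m := by omega
      rw [he, Nat.mod_self]; omega
  · -- (t,true) ~ (t,false)
    subst h
    apply natAdj_symm
    apply key; left; simp [kOf]
  · -- (t,true) ~ (t+1,false)
    subst h
    apply key
    simp only [kOf, Bool.toNat_true, Bool.toNat_false, add_zero, Fin.val_add]
    have ht := t.isLt
    rw [Fin.val_one', Nat.mod_eq_of_lt (show 1 < R.m by have := R.a_lt; unfold m; omega)]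
    by_cases hc : t.val + 1 < R.m
    · left; rw [Nat.mod_eq_of_lt hc]; ring
    · right
      have he : t.val + 1 = R.m := by omega
      rw [he, Nat.mod_self]; omega

/-- The hub positions `u = a`, `v = hw + b`, `w = hw + hh + c` (half boundary indices). [folklore] -/
def hub : Fin 3 → Fin R.m :=
  ![⟨R.a, by have := R.a_lt; unfold m; omega⟩,
    ⟨R.hw + R.b, by have := R.b_lt; unfold m; omega⟩,
    ⟨R.hw + R.hh + R.c, by have := R.c_lt; unfold m; omega⟩]

/-- Half boundary index of `u`. [folklore] -/
@[simp] theorem hub_zero_val : (R.hub 0).val = R.a := rfl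

/-- Half boundary index of `v`. [folklore] -/
@[simp] theorem hub_one_val : (R.hub 1).val = R.hw + R.b := rfl

/-- Half boundary index of `w`. [folklore] -/
@[simp] theorem hub_two_val : (R.hub 2).val = R.hw + R.hh + R.c := rfl

/-- **The rectangle necklace** with hubs `u, v, w` on the top, right and bottom sides.
(Bravyi–Gosset–König 2018, §4.2, the cycle `Γ` of Claim 7, here a rectangle.) [cite: BravyiGossetKonigScience2018, §4.2 Claim 7] -/
def necklace : Necklace N R.m where
  toFun := R.toFun
  injective := R.toFun_injective
  adj := R.toFun_adj
  hub := R.hub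
  hub_lt₀₁ := by rw [Fin.lt_def, hub_zero_val, hub_one_val]; have := R.a_lt; omega
  hub_lt₁₂ := by rw [Fin.lt_def, hub_one_val, hub_two_val]; have := R.b_lt; omega

/-- The embedding of the rectangle necklace (definitional unfolding). [folklore] -/
@[simp] theorem necklace_toFun : R.necklace.toFun = R.toFun := rfl

/-- The hubs of the rectangle necklace (definitional unfolding). [folklore] -/
@[simp] theorem necklace_hub : R.necklace.hub = R.hub := rfl

/-! ### Sides (zones) -/

/-- The zone of a necklace position: `0` (hub `u`) on the top side `[0, 2hw)` and the left side
`[4hw + 2hh, 2m)`, `1` (hub `v`) on the right side `[2hw, 2hw + 2hh)`, `2` (hub `w`) on the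
bottom side `[2hw + 2hh, 4hw + 2hh)` (boundary indices). Downstream, the output bit at a
position may only depend on the input bit of the hub of its zone. [cite: BravyiGossetKonigScience2018, §4.2 Claim 7] -/
def zone (p : Fin R.m × Bool) : Fin 3 :=
  if R.kOf p < 2 * R.hw then 0
  else if R.kOf p < 2 * R.hw + 2 * R.hh then 1
  else if R.kOf p < 4 * R.hw + 2 * R.hh then 2
  else 0

/-- **Zones are sides.** A position of zone `0` lies on the top row `r₁` or the left column
`c₁`; a position of zone `1` lies on the right column `c₁ + 2hw`; a position of zone `2` lies
on the bottom row `r₁ + 2hh`. [folklore] -/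
theorem zone_spec (p : Fin R.m × Bool) :
    (R.zone p = 0 ∧ ((R.toFun p).1.val = R.r₁ ∨ (R.toFun p).2.val = R.c₁)) ∨
    (R.zone p = 1 ∧ (R.toFun p).2.val = R.c₁ + 2 * R.hw) ∨
    (R.zone p = 2 ∧ (R.toFun p).1.val = R.r₁ + 2 * R.hh) := by
  have hk := R.kOf_lt p
  simp only [toFun]
  unfold zone posRow posCol m at *
  split_ifs <;> (first
    | (exact Or.inl ⟨rfl, by omega⟩)
    | (exact Or.inr (Or.inl ⟨rfl, by omega⟩))
    | (exact Or.inr (Or.inr ⟨rfl, by omega⟩)))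

/-- **Zones avoid the opposite hub.** The zone hub of an odd position is never the hub opposite
to the triangle side containing it: the top and left sides lie on the sides `L = (u,v)` and
`B = (w,u)` through `u`, the right side on `L` and `R = (v,w)` through `v`, the bottom side on `R`
and `B` through `w`. [cite: BravyiGossetKonigScience2018, §4.1 Fig. 2] -/
theorem zone_ne_arcOf (t : Fin R.m) : R.zone (t, true) ≠ R.necklace.arcOf t := by
  have ht := t.isLt
  have h1 := R.a_lt; have h2 := R.b_lt; have h3 := R.c_lt
  unfold zone Necklace.arcOf kOf
  simp only [necklace_hub, Fin.lt_def, hub_zero_val, hub_one_val, hub_two_val, Bool.toNat_true]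
  unfold m at ht
  split_ifs <;> first | decide | (exfalso; omega)

/-- Coordinates of the hub `u = (r₁, c₁ + 2a)`. [folklore] -/
theorem toFun_hub_zero : ((R.toFun (R.hub 0, false)).1.val = R.r₁) ∧ (R.toFun (R.hub 0, false)).2.val = R.c₁ + 2 * R.a := by
  have h1 := R.a_lt
  simp only [toFun, kOf, hub_zero_val, Bool.toNat_false, add_zero]
  unfold posRow posCol
  constructor <;> (split_ifs <;> omega)

/-- Coordinates of the hub `v = (r₁ + 2b, c₁ + 2hw)`. [folklore] -/
theorem toFun_hub_one : ((R.toFun (R.hub 1, false)).1.val = R.r₁ + 2 * R.b) ∧ (R.toFun (R.hub 1, false)).2.val = R.c₁ + 2 * R.hw := by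
  have h1 := R.b_lt; have h0 := R.b_pos
  simp only [toFun, kOf, hub_one_val, Bool.toNat_false, add_zero]
  unfold posRow posCol
  constructor <;> (split_ifs <;> omega)

/-- Coordinates of the hub `w = (r₁ + 2hh, c₁ + 2hw - 2c)`. [folklore] -/
theorem toFun_hub_two : ((R.toFun (R.hub 2, false)).1.val = R.r₁ + 2 * R.hh) ∧ (R.toFun (R.hub 2, false)).2.val = R.c₁ + 2 * R.hw - 2 * R.c := by
  have h1 := R.c_lt; have h0 := R.c_pos
  simp only [toFun, kOf, hub_two_val, Bool.toNat_false, add_zero]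
  unfold posRow posCol
  constructor <;> (split_ifs <;> omega)

/-- **A rectangle necklace through three given hubs.** If `u, v, w` have even coordinates with
`u` in the top strip, `v` in the right strip and `w` in the bottom strip of the grid (strips of
width `2n`, `8n ≤ N`), there is a rectangle necklace with left column `0`, top row through `u`,
right column through `v`, bottom row through `w`, and hubs exactly `u, v, w`.
(Bravyi–Gosset–König 2018, §4.2, Claim 7: a cycle through the chosen triple.) [cite: BravyiGossetKonigScience2018, §4.2 Claim 7] -/
theorem exists_of_hubs {N n : ℕ} (u v w : Fin N × Fin N)
    (hu : u.1.val < 2 * n ∧ 2 * n ≤ u.2.val ∧ u.2.val < 6 * n ∧ u.1.val % 2 = 0 ∧ u.2.val % 2 = 0)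
    (hv : 2 * n ≤ v.1.val ∧ v.1.val < 6 * n ∧ 6 * n ≤ v.2.val ∧ v.1.val % 2 = 0 ∧ v.2.val % 2 = 0)
    (hw : 6 * n ≤ w.1.val ∧ 2 * n ≤ w.2.val ∧ w.2.val < 6 * n ∧ w.1.val % 2 = 0 ∧ w.2.val % 2 = 0) :
    ∃ R : RectData N, R.r₁ = u.1.val ∧ R.c₁ = 0 ∧ R.c₁ + 2 * R.hw = v.2.val ∧ R.r₁ + 2 * R.hh = w.1.val ∧
      R.toFun (R.hub 0, false) = u ∧ R.toFun (R.hub 1, false) = v ∧ R.toFun (R.hub 2, false) = w := by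
  have hv2 := v.2.isLt
  have hw1 := w.1.isLt
  obtain ⟨hu1, hu2, hu3, hu4, hu5⟩ := hu
  obtain ⟨hv1, hv1', hv3, hv4, hv5⟩ := hv
  obtain ⟨hw0, hw2', hw3, hw4, hw5⟩ := hw
  let R : RectData N :=
    { r₁ := u.1.val, c₁ := 0, hw := v.2.val / 2, hh := (w.1.val - u.1.val) / 2, a := u.2.val / 2,
      b := (v.1.val - u.1.val) / 2, c := (v.2.val - w.2.val) / 2,
      a_pos := by omega, a_lt := by omega, b_pos := by omega, b_lt := by omega, c_pos := by omega,
      c_lt := by omega, row_lt := by omega, col_lt := by omega }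
  refine ⟨R, rfl, rfl, ?_, ?_, ?_, ?_, ?_⟩
  · show 0 + 2 * (v.2.val / 2) = v.2.val
    omega
  · show u.1.val + 2 * ((w.1.val - u.1.val) / 2) = w.1.val
    omega
  · have h := R.toFun_hub_zero
    refine Prod.ext (Fin.ext h.1) (Fin.ext ?_)
    rw [h.2]
    show 0 + 2 * (u.2.val / 2) = u.2.val
    omega
  · have h := R.toFun_hub_one
    refine Prod.ext (Fin.ext ?_) (Fin.ext ?_)
    · rw [h.1]
      show u.1.val + 2 * ((v.1.val - u.1.val) / 2) = v.1.val
      omega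
    · rw [h.2]
      show 0 + 2 * (v.2.val / 2) = v.2.val
      omega
  · have h := R.toFun_hub_two
    refine Prod.ext (Fin.ext ?_) (Fin.ext ?_)
    · rw [h.1]
      show u.1.val + 2 * ((w.1.val - u.1.val) / 2) = w.1.val
      omega
    · rw [h.2]
      show 0 + 2 * (v.2.val / 2) - 2 * ((v.2.val - w.2.val) / 2) = w.2.val
      omega

end RectData

end Literature.Computability.QuantumComplexity
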